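import Summits.CriticalPhenomena.PercolationContinuityZ3.Theorems.PercNearOneGluingNoHeavyLowerTailSunflowerMultiPetalTileG
import HarnessLib
import HarnessLib.Audit

/-!
# `NoHeavyLowerTail` (crux stmt-CriticalPhenomena-4575), abstract sunflower cubic, `k` petals: the CORE REDUCTION — ★ₖ and Conjecture G for a structure follow from
# ★ₖ resp. G on the window left after deleting any family of pairwise disjoint NON-BOTTOM MODULES

Support file (seat `prim-l12-p2` gen 33; `--supports stmt-CriticalPhenomena-4575`; companion of `…SunflowerMultiPetalModuleLift` (p371847: `gsum_nonneg_of_isModule_of_upper`) and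
`…SunflowerMultiPetalTileG` (this gen: `gsumFlip_nonneg_of_isModule_of_upper`)).  Everything here is PROVED; no `sorry`.
Memo: run/shared/lean/prim/prim-l12/prim-l12-p2/FINDING-g33-MODULE-LIFT.md §1.11.

The tiling inductions of `…ModuleLift` (★ₖ) and `…TileG` (G) consume one non-bottom module per step and only ever ask for the UNGLUED functional of the remaining window.
Starting them from an arbitrary base window `W₀` instead of `∅`:
* `gsum_core_biUnion_nonneg_of_modules` / **`ZK_nonneg_of_core_and_modules`**: `0 ≤ gsum W₀ ∅ ∅ ∅` ⟹ `0 ≤ ZK` whenever `univ = W₀ ⊔ ⨆ M i` with modules `M i`, `lab (M i) ≠ 0`;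
* `gsumFlip_core_biUnion_nonneg_of_modules` / **`ZKflip_nonneg_of_core_and_modules`**: `(∀ D, 0 ≤ gsumFlip W₀ D ∅ ∅ ∅)` ⟹ `∀ D, 0 ≤ ZKflip D` under the same tiling.
So a minimal counterexample to ★ₖ or to Conjecture G can be shrunk to its CORE: the window complementary to any maximal family of pairwise disjoint non-bottom modules.
-/

namespace Summit.CriticalPhenomena.PercolationContinuityZ3.Theorems.SunflowerPartition

open Finset

variable {α : Type*} [DecidableEq α]

namespace MSunflower

variable {k : ℕ} (F : MSunflower k α)

/-- **Core + tiles, ★ₖ (window form)**: if `W₀` is disjoint from the pairwise disjoint modules `M i` (`i ∈ s`, `lab (M i) ≠ 0`) and `0 ≤ gsum W₀ ∅ ∅ ∅`, then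
`0 ≤ gsum (W₀ ∪ ⋃ M i) ∅ ∅ ∅`. [this work] -/
theorem gsum_core_biUnion_nonneg_of_modules {ι : Type*} [DecidableEq ι] (W₀ : Finset α) (s : Finset ι) (M : ι → Finset α) (g : ι → (Finset α → Bool))
    (hmod : ∀ i ∈ s, F.IsModule (M i) (g i)) (hlab : ∀ i ∈ s, F.lab (M i) ≠ 0)
    (hdisj : ∀ i ∈ s, ∀ j ∈ s, i ≠ j → Disjoint (M i) (M j)) (h0disj : ∀ i ∈ s, Disjoint W₀ (M i))
    (h0 : 0 ≤ F.gsum W₀ ∅ ∅ ∅) : 0 ≤ F.gsum (W₀ ∪ s.biUnion M) ∅ ∅ ∅ := by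
  induction s using Finset.induction_on with
  | empty => rw [biUnion_empty, union_empty]; exact h0
  | insert i s hi ih =>
    have hmod' : ∀ j ∈ s, F.IsModule (M j) (g j) := fun j hj => hmod j (mem_insert_of_mem hj)
    have hlab' : ∀ j ∈ s, F.lab (M j) ≠ 0 := fun j hj => hlab j (mem_insert_of_mem hj)
    have hdisj' : ∀ j ∈ s, ∀ j' ∈ s, j ≠ j' → Disjoint (M j) (M j') :=
      fun j hj j' hj' hne => hdisj j (mem_insert_of_mem hj) j' (mem_insert_of_mem hj') hne
    have h0disj' : ∀ j ∈ s, Disjoint W₀ (M j) := fun j hj => h0disj j (mem_insert_of_mem hj)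
    have ih' := ih hmod' hlab' hdisj' h0disj'
    have hd : Disjoint (M i) (W₀ ∪ s.biUnion M) := by
      rw [disjoint_union_right, disjoint_biUnion_right]
      refine ⟨(h0disj i (mem_insert_self i s)).symm, fun j hj => ?_⟩
      exact hdisj i (mem_insert_self i s) j (mem_insert_of_mem hj) (fun h => hi (h ▸ hj))
    have hW : (W₀ ∪ (insert i s).biUnion M) \ M i = W₀ ∪ s.biUnion M := by
      rw [biUnion_insert, union_left_comm, union_sdiff_left, Finset.sdiff_eq_self_iff_disjoint]
      exact hd.symm
    refine F.gsum_nonneg_of_isModule_of_upper (hmod i (mem_insert_self i s)) ?_ (F.lab (M i))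
      (fun X _ => F.lab_union_cases_of_lab_ne_zero (M i) X (hlab i (mem_insert_self i s))) ?_
    · rw [biUnion_insert, union_left_comm]; exact subset_union_left
    · rw [hW]; exact ih'

/-- **CORE REDUCTION FOR ★ₖ**: if `univ = W₀ ∪ ⋃ M i` with `W₀` disjoint from the pairwise disjoint non-bottom modules `M i`, then ★ₖ on the core window `W₀`
(`0 ≤ gsum W₀ ∅ ∅ ∅`) implies `0 ≤ ZK`. [this work] -/
theorem ZK_nonneg_of_core_and_modules [Fintype α] {ι : Type*} [DecidableEq ι] (W₀ : Finset α) (s : Finset ι) (M : ι → Finset α) (g : ι → (Finset α → Bool))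
    (hmod : ∀ i ∈ s, F.IsModule (M i) (g i)) (hlab : ∀ i ∈ s, F.lab (M i) ≠ 0)
    (hdisj : ∀ i ∈ s, ∀ j ∈ s, i ≠ j → Disjoint (M i) (M j)) (h0disj : ∀ i ∈ s, Disjoint W₀ (M i))
    (hcov : W₀ ∪ s.biUnion M = univ) (h0 : 0 ≤ F.gsum W₀ ∅ ∅ ∅) : 0 ≤ F.ZK := by
  rw [F.ZK_eq_gsum, ← hcov]
  exact F.gsum_core_biUnion_nonneg_of_modules W₀ s M g hmod hlab hdisj h0disj h0

/-- **Core + tiles, Conjecture G (window form)**: under the same tiling, `(∀ D, 0 ≤ gsumFlip W₀ D ∅ ∅ ∅)` implies `0 ≤ gsumFlip (W₀ ∪ ⋃ M i) D ∅ ∅ ∅` for every `D`.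
[this work] -/
theorem gsumFlip_core_biUnion_nonneg_of_modules {ι : Type*} [DecidableEq ι] (W₀ : Finset α) (s : Finset ι) (M : ι → Finset α) (g : ι → (Finset α → Bool))
    (hmod : ∀ i ∈ s, F.IsModule (M i) (g i)) (hlab : ∀ i ∈ s, F.lab (M i) ≠ 0)
    (hdisj : ∀ i ∈ s, ∀ j ∈ s, i ≠ j → Disjoint (M i) (M j)) (h0disj : ∀ i ∈ s, Disjoint W₀ (M i))
    (h0 : ∀ D : Finset α, 0 ≤ F.gsumFlip W₀ D ∅ ∅ ∅) : ∀ D : Finset α, 0 ≤ F.gsumFlip (W₀ ∪ s.biUnion M) D ∅ ∅ ∅ := by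
  induction s using Finset.induction_on with
  | empty => intro D; rw [biUnion_empty, union_empty]; exact h0 D
  | insert i s hi ih =>
    intro D
    have hmod' : ∀ j ∈ s, F.IsModule (M j) (g j) := fun j hj => hmod j (mem_insert_of_mem hj)
    have hlab' : ∀ j ∈ s, F.lab (M j) ≠ 0 := fun j hj => hlab j (mem_insert_of_mem hj)
    have hdisj' : ∀ j ∈ s, ∀ j' ∈ s, j ≠ j' → Disjoint (M j) (M j') :=
      fun j hj j' hj' hne => hdisj j (mem_insert_of_mem hj) j' (mem_insert_of_mem hj') hne
    have h0disj' : ∀ j ∈ s, Disjoint W₀ (M j) := fun j hj => h0disj j (mem_insert_of_mem hj)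
    have hd : Disjoint (M i) (W₀ ∪ s.biUnion M) := by
      rw [disjoint_union_right, disjoint_biUnion_right]
      refine ⟨(h0disj i (mem_insert_self i s)).symm, fun j hj => ?_⟩
      exact hdisj i (mem_insert_self i s) j (mem_insert_of_mem hj) (fun h => hi (h ▸ hj))
    have hW : (W₀ ∪ (insert i s).biUnion M) \ M i = W₀ ∪ s.biUnion M := by
      rw [biUnion_insert, union_left_comm, union_sdiff_left, Finset.sdiff_eq_self_iff_disjoint]
      exact hd.symm
    refine F.gsumFlip_nonneg_of_isModule_of_upper (hmod i (mem_insert_self i s)) ?_ (F.lab (M i))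
      (fun X => F.lab_union_cases_of_lab_ne_zero (M i) X (hlab i (mem_insert_self i s))) D ?_
    · rw [biUnion_insert, union_left_comm]; exact subset_union_left
    · rw [hW]; exact ih hmod' hlab' hdisj' h0disj' (D \ M i)

/-- **CORE REDUCTION FOR CONJECTURE G**: if `univ = W₀ ∪ ⋃ M i` as above, then G on the core window (`∀ D, 0 ≤ gsumFlip W₀ D ∅ ∅ ∅`) implies `0 ≤ ZKflip D` for every `D`.
[this work] -/
theorem ZKflip_nonneg_of_core_and_modules [Fintype α] {ι : Type*} [DecidableEq ι] (W₀ : Finset α) (s : Finset ι) (M : ι → Finset α) (g : ι → (Finset α → Bool))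
    (hmod : ∀ i ∈ s, F.IsModule (M i) (g i)) (hlab : ∀ i ∈ s, F.lab (M i) ≠ 0)
    (hdisj : ∀ i ∈ s, ∀ j ∈ s, i ≠ j → Disjoint (M i) (M j)) (h0disj : ∀ i ∈ s, Disjoint W₀ (M i))
    (hcov : W₀ ∪ s.biUnion M = univ) (h0 : ∀ D : Finset α, 0 ≤ F.gsumFlip W₀ D ∅ ∅ ∅) (D : Finset α) : 0 ≤ F.ZKflip D := by
  rw [F.ZKflip_eq_gsumFlip, ← hcov]
  exact F.gsumFlip_core_biUnion_nonneg_of_modules W₀ s M g hmod hlab hdisj h0disj h0 D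

end MSunflower

end Summit.CriticalPhenomena.PercolationContinuityZ3.Theorems.SunflowerPartition
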